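import Literature.NumberTheory.Rogawski1990.ArchCentralLimitChamberSmooth          -- ★ p843674 (F0P3a-p02 (g12)): `contDiffOn_letterIntegrand_angleChart_chamber_ball`; brings ★ the jet sockets `of_chamberJetBounds_local`, chambers
import Literature.NumberTheory.Automorphic.ArchLocalDiagonalFrameU21                -- ★ p843380∕p843389 (A-p18): the frame `G_w ≃ₜ* U(2,1)`, `integral_comp_conj_eq_integral_map_mkU21`, transported Haar ∕ test function
import Literature.Geometry.ComplexHyperbolic.UnitBallLieAlgebraTransfer              -- ★ p846559 (F0P3a-p02 (g14), (a2-B)): `orbital_eq_lieOrbital`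
import Literature.Geometry.ComplexHyperbolic.UnitBallLieAlgebraHCClosure             -- ★ p846595 (F0P3a-p05 (g15), (d2) FILE 1): `contDiffAt_liePhi`
import Mathlib.Analysis.Complex.RemovableSingularity
import Mathlib.Analysis.Calculus.ContDiff.Bounds
import HarnessLib

/-!
# ROAD «A6-IV» brick (f1): the letter's FOURTH-JET BOUND on every chamber from Harish-Chandra's jet bounds for `φ_f = π·Φ_f` on the Lie algebra
# (Warner, *Harmonic Analysis on Semi-Simple Lie Groups II* Thm. 8.4.3.1 ⟹ Thm. 8.5.1.1 at a central point; Rogawski 1990 §8.4 p. 126)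

Topic `NumberTheory/Rogawski1990`; namespace `Literature.NumberTheory.Rogawski1990` (§1 in `Literature.Geometry.ComplexHyperbolic.BallModel`, §2 generic in `Literature.Analysis.Calculus`).
THEOREMS ONLY (no `def`, no instance, no notation, no axiom, no named fact, no `sorry`).  Cell `pub/hodgecm-mathlib`, ENGINE T1 (crux H413 = `stmt-HodgeConjecture-24833`); ROAD A
(N1 = `stub_L21` ∕ print row #179 (A6)→(A6-lim)), design of record `DESIGN-A6-InHouse-v2-ArchitectureIV` 93542b84 §2 (f1) (owner∕architect F0P3a-p05 (g15); LEAD F0P3a-plan T11-4∕T11-19);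
pen F0P3a-p02 (g15), 2026-09-01.

THE MATHEMATICS.  The jet-bound socket ★ `ArchCentralLimitFormulaRankTwo.of_chamberJetBounds_local` asks, per chamber `C_σ`, for `∃ r > 0, M` with `F_Θ∘chart` of class `C⁴` on
`C_σ ∩ B(0,r)` and `‖D⁴(F_Θ∘chart)‖ ≤ M` there, where `F_Θ(z) = ρ(z)·′Δ(z)·∫_{G_w} Θ(g·diag z·g⁻¹) dν` and `chart_ζ(θ) = (ζe^{iθ_k})_k`.  Harish-Chandra's theorem (Warner Thm. 8.4.3.1,
the cell's ROAD «A6-IV» brick (d2)) bounds instead the jets of `φ_f = π·Φ_f` ON THE LIE ALGEBRA: `liePhi μ f θ = rootProduct θ • ∫_{U(2,1)} f(Ad(u)·torusH θ) dμ`.  This file is the transfer: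
* §1 **`exists_smooth_rhoWeylDelta_angleChart_eq_mul_rootProduct`** — the Weyl factor FACTORS THROUGH `π`: `ρ′Δ(ζe^{iθ}) = u(θ)·rootProduct θ` with ONE real-smooth `u : ℝ³ → ℂ`, `u(0) = −i ≠ 0`,
  independent of `ζ` (`1 − e^{ix} = −ix·E(ix)` with `E = dslope exp 0 = (e^w − 1)∕w`, an entire function — Mathlib `differentiableOn_dslope` + `Differentiable.contDiff`);
* §2 (generic) a Leibniz bound `‖Dⁿ(u·g)‖ ≤ 2ⁿ·A·B` on an open set from order-`≤ n` bounds `A`, `B` of the factors (Mathlib `norm_iteratedFDerivWithin_mul_le`), and the packaging of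
  order-wise bounds `∀ i, ∃ M_i` ∕ of a globally smooth factor on a compact ball into one constant;
* §3 **`exists_frame_testFunction_orbital_eq_lieOrbital`** — at a frame with `re σ_wα₀, re σ_wα₁ > 0 > re σ_wα₂`: ★ A-p18's diagonal frame `e : G_w ≃ₜ* U(2,1)` (identity on the torus) and
  ★ (a2-B) give ONE `f ∈ C_c^∞(M₃(ℂ))` with `∫_{G_w} Θ(g·diag(ζe^{iθ})·g⁻¹) dν = lieOrbital (ν.map e) f (torusH θ)` for all `|θ_k| ≤ 1∕4`; `ν.map e` is Haar and right-invariant;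
* §4 HEADS **`letterJetBound_of_liePhiJetBounds`** — the socket's `(∃ r M, …)` clause at `r = 1∕4` from the (d2) output shape (owner R-15.9: for every Haar right-invariant `μ` on `U(2,1)` and
  every `f ∈ C_c^∞`, `∀ n, ∃ M, ∀ θ ∈ C_σ ∩ B(0,1∕4), ‖Dⁿ(liePhi μ f) θ‖ ≤ M`), since on `C_σ ∩ B(0,1∕4)` one has `F_Θ∘chart = u · liePhi (ν.map e) f` (§1+§3) with both factors `C^∞`
  there (★ `contDiffOn_letterIntegrand_angleChart_chamber_ball`, ★ `contDiffAt_liePhi`); and **`ArchCentralLimitFormulaRankTwo.of_liePhiJetBounds_of_values`** — THE LETTER at such a frame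
  from the (d2) bounds on all six chambers + the socket's value clause (left as hypothesis: brick (f2)).
HONEST LABEL: HC_CM is proved only modulo the printed citations until rung 0 closes; this file is plumbing between two in-house bricks and pays nothing by itself.

## References
* [WarnerHASSLG2] G. Warner, *Harmonic Analysis on Semi-Simple Lie Groups II*, Grundlehren 189 (1972), §8.4.1 (`φ_f = π·Φ_f`), Thm. 8.4.3.1, §8.5.1 Thm. 8.5.1.1.
* [Rogawski1990] J. D. Rogawski, *Automorphic Representations of Unitary Groups in Three Variables*, Ann. of Math. Stud. 123 (1990), §8.4 pp. 126–127 (`F = ρ′Δ·Φ`, the compact Cartan `T`).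
-/

set_option autoImplicit false

noncomputable section

open Filter Topology Set Function Metric MeasureTheory Measure Complex
open scoped ContDiff NNReal

/-! ## §1 The Weyl factor `ρ′Δ(ζe^{iθ})` factors through Harish-Chandra's `π = rootProduct` with a smooth nonvanishing cofactor -/

namespace Literature.Geometry.ComplexHyperbolic.BallModel

/-- The removable quotient `E(w) = (e^w − 1)∕w` (`= dslope exp 0`) is an entire function, hence real-smooth. [cite: WarnerHASSLG2, §8.4.1] -/
theorem contDiff_dslope_cexp_zero : ContDiff ℝ ∞ (dslope Complex.exp 0) := by
  have hd : Differentiable ℂ (dslope Complex.exp 0) := by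
    have h := (differentiableOn_dslope (Filter.univ_mem : (Set.univ : Set ℂ) ∈ 𝓝 (0 : ℂ))).2 Complex.differentiable_exp.differentiableOn
    exact differentiableOn_univ.1 h
  exact (hd.contDiff (n := ∞)).restrict_scalars ℝ

/-- `w · E(w) = e^w − 1`. [cite: WarnerHASSLG2, §8.4.1] -/
theorem mul_dslope_cexp_zero (w : ℂ) : w * dslope Complex.exp 0 w = Complex.exp w - 1 := by
  have h := sub_smul_dslope Complex.exp 0 w
  simpa only [sub_zero, smul_eq_mul, Complex.exp_zero] using h

/-- `E(0) = 1`. [cite: WarnerHASSLG2, §8.4.1] -/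
theorem dslope_cexp_zero_zero : dslope Complex.exp 0 0 = 1 := by
  rw [dslope_same, Complex.deriv_exp, Complex.exp_zero]

/-- `1 − e^{i(a−b)} = i(b−a)·E(i(a−b))`. [cite: WarnerHASSLG2, §8.4.1] -/
theorem one_sub_cexp_mul_I_eq (a b : ℝ) :
    1 - Complex.exp (((a - b : ℝ) : ℂ) * I) = (((b - a : ℝ) : ℂ) * I) * dslope Complex.exp 0 (((a - b : ℝ) : ℂ) * I) := by
  have h := mul_dslope_cexp_zero (((a - b : ℝ) : ℂ) * I)
  push_cast at h ⊢
  linear_combination h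

/-- The torus ratio in the letter's tokens: `(ζe^{ia})·(ζe^{ib})⁻¹ = e^{i(a−b)}`. [cite: Rogawski1990, §8.4 p. 126] -/
theorem coe_circle_mul_exp_mul_inv (ζ : Circle) (a b : ℝ) :
    (((ζ * Circle.exp a : Circle) : ℂ)) * (((ζ * Circle.exp b : Circle) : ℂ))⁻¹ = Complex.exp (((a - b : ℝ) : ℂ) * I) := by
  rw [Circle.coe_mul, Circle.coe_mul, Circle.coe_exp, Circle.coe_exp]
  have hζ : (ζ : ℂ) ≠ 0 := Circle.coe_ne_zero ζ
  have hb : Complex.exp ((b : ℂ) * I) ≠ 0 := Complex.exp_ne_zero _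
  push_cast
  rw [sub_mul, Complex.exp_sub]
  field_simp

/-- **THE WEYL FACTOR FACTORS THROUGH `π`**: there is ONE real-smooth `u : ℝ³ → ℂ` with `u(0) ≠ 0` (indeed `u(0) = −i`) such that for every centre `ζ` and all angles `θ`,
`ρ′Δ(ζe^{iθ}) = u(θ)·rootProduct θ` in the letter's exact tokens (`ρ = z₀z₂⁻¹`, `′Δ = (1 − z₁z₀⁻¹)(1 − z₂z₁⁻¹)(1 − z₂z₀⁻¹)`).  So jet bounds for HC's `φ_f = π·Φ_f` ARE jet bounds for
Rogawski's `F_Θ = ρ′Δ·Φ_Θ` near the centre. [cite: Rogawski1990, §8.4 p. 126] [cite: WarnerHASSLG2, §8.4.1] -/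
theorem exists_smooth_rhoWeylDelta_angleChart_eq_mul_rootProduct :
    ∃ u : (Fin 3 → ℝ) → ℂ, ContDiff ℝ ∞ u ∧ u 0 ≠ 0 ∧ ∀ (ζ : Circle) (θ : Fin 3 → ℝ),
      ((((ζ * Circle.exp (θ 0) : Circle) : ℂ)) * (((ζ * Circle.exp (θ 2) : Circle) : ℂ))⁻¹) * ((1 - (((ζ * Circle.exp (θ 1) : Circle) : ℂ)) * (((ζ * Circle.exp (θ 0) : Circle) : ℂ))⁻¹) * (1 - (((ζ * Circle.exp (θ 2) : Circle) : ℂ)) * (((ζ * Circle.exp (θ 1) : Circle) : ℂ))⁻¹) * (1 - (((ζ * Circle.exp (θ 2) : Circle) : ℂ)) * (((ζ * Circle.exp (θ 0) : Circle) : ℂ))⁻¹))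
        = u θ * ((rootProduct θ : ℝ) : ℂ) := by
  refine ⟨fun θ => -I * Complex.exp (((θ 0 - θ 2 : ℝ) : ℂ) * I) * dslope Complex.exp 0 (((θ 1 - θ 0 : ℝ) : ℂ) * I) *
      dslope Complex.exp 0 (((θ 2 - θ 1 : ℝ) : ℂ) * I) * dslope Complex.exp 0 (((θ 2 - θ 0 : ℝ) : ℂ) * I), ?_, ?_, ?_⟩
  · have hlin : ∀ i j : Fin 3, ContDiff ℝ ∞ (fun θ : Fin 3 → ℝ => ((θ i - θ j : ℝ) : ℂ) * I) := fun i j =>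
      (Complex.ofRealCLM.contDiff.comp ((contDiff_apply ℝ ℝ i).sub (contDiff_apply ℝ ℝ j))).mul contDiff_const
    have hE := contDiff_dslope_cexp_zero
    exact (((contDiff_const.mul (Complex.contDiff_exp.comp (hlin 0 2))).mul (hE.comp (hlin 1 0))).mul (hE.comp (hlin 2 1))).mul (hE.comp (hlin 2 0))
  · simp only [Pi.zero_apply, sub_self, Complex.ofReal_zero, zero_mul, Complex.exp_zero, dslope_cexp_zero_zero, mul_one, ne_eq, neg_eq_zero,
      Complex.I_ne_zero, not_false_eq_true]
  · intro ζ θ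
    rw [coe_circle_mul_exp_mul_inv ζ (θ 0) (θ 2), coe_circle_mul_exp_mul_inv ζ (θ 1) (θ 0), coe_circle_mul_exp_mul_inv ζ (θ 2) (θ 1),
      coe_circle_mul_exp_mul_inv ζ (θ 2) (θ 0), one_sub_cexp_mul_I_eq, one_sub_cexp_mul_I_eq, one_sub_cexp_mul_I_eq]
    simp only [rootProduct]
    push_cast
    linear_combination (Complex.exp ((↑(θ 0) - ↑(θ 2)) * I) * dslope Complex.exp 0 ((↑(θ 1) - ↑(θ 0)) * I) * dslope Complex.exp 0 ((↑(θ 2) - ↑(θ 1)) * I) *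
      dslope Complex.exp 0 ((↑(θ 2) - ↑(θ 0)) * I) * (↑(θ 0) - ↑(θ 1)) * (↑(θ 1) - ↑(θ 2)) * (↑(θ 0) - ↑(θ 2)) * I) * Complex.I_sq

end Literature.Geometry.ComplexHyperbolic.BallModel

/-! ## §2 Generic: a Leibniz bound on an open set, and packaging of order-wise bounds -/

namespace Literature.Analysis.Calculus

variable {V : Type*} [NormedAddCommGroup V] [NormedSpace ℝ V]

/-- **LEIBNIZ BOUND ON AN OPEN SET**: if `u, g : V → ℂ` are `Cⁿ` on the open set `S` with `‖Dⁱu‖ ≤ A` and `‖Dⁱg‖ ≤ B` on `S` for all `i ≤ n`, then `‖Dⁿ(u·g)‖ ≤ 2ⁿ·A·B` on `S`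
(Mathlib `norm_iteratedFDerivWithin_mul_le` on `S`, `Σ_i C(n,i) = 2ⁿ`; on an open set `iteratedFDerivWithin = iteratedFDeriv`). [cite: WarnerHASSLG2, §8.5.1] -/
theorem norm_iteratedFDeriv_mul_le_of_isOpen {S : Set V} (hS : IsOpen S) {u g : V → ℂ} {n : ℕ}
    (hu : ContDiffOn ℝ n u S) (hg : ContDiffOn ℝ n g S) {A B : ℝ} (hA : 0 ≤ A)
    (huA : ∀ i ≤ n, ∀ x ∈ S, ‖iteratedFDeriv ℝ i u x‖ ≤ A) (hgB : ∀ i ≤ n, ∀ x ∈ S, ‖iteratedFDeriv ℝ i g x‖ ≤ B) :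
    ∀ x ∈ S, ‖iteratedFDeriv ℝ n (fun y => u y * g y) x‖ ≤ 2 ^ n * A * B := by
  intro x hx
  have hB : 0 ≤ B := (norm_nonneg _).trans (hgB 0 (Nat.zero_le n) x hx)
  have h := norm_iteratedFDerivWithin_mul_le (𝕜 := ℝ) (A := ℂ) hu hg hS.uniqueDiffOn hx (n := n) le_rfl
  rw [iteratedFDerivWithin_of_isOpen n hS hx] at h
  refine h.trans ?_
  calc ∑ i ∈ Finset.range (n + 1), (n.choose i : ℝ) * ‖iteratedFDerivWithin ℝ i u S x‖ * ‖iteratedFDerivWithin ℝ (n - i) g S x‖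
      ≤ ∑ i ∈ Finset.range (n + 1), (n.choose i : ℝ) * A * B := by
        refine Finset.sum_le_sum fun i hi => ?_
        have hi' : i ≤ n := Nat.lt_succ_iff.mp (Finset.mem_range.mp hi)
        rw [iteratedFDerivWithin_of_isOpen i hS hx, iteratedFDerivWithin_of_isOpen (n - i) hS hx]
        have h1 := huA i hi' x hx
        have h2 := hgB (n - i) (Nat.sub_le n i) x hx
        have hc : (0 : ℝ) ≤ (n.choose i : ℝ) := Nat.cast_nonneg _
        calc (n.choose i : ℝ) * ‖iteratedFDeriv ℝ i u x‖ * ‖iteratedFDeriv ℝ (n - i) g x‖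
            ≤ (n.choose i : ℝ) * A * ‖iteratedFDeriv ℝ (n - i) g x‖ := by gcongr
          _ ≤ (n.choose i : ℝ) * A * B := by gcongr
    _ = 2 ^ n * A * B := by
        rw [← Finset.sum_mul, ← Finset.sum_mul]
        congr 2
        have h2n := Nat.sum_range_choose n
        exact_mod_cast h2n

/-- Order-wise bounds `∀ i, ∃ M_i` on a set give ONE bound for all orders `≤ n` (bookkeeping form of «all derivatives of order `≤ n` bounded»). [cite: WarnerHASSLG2, §8.5.1 Thm. 8.5.1.1] -/
theorem exists_forall_le_norm_iteratedFDeriv_le {F : Type*} [NormedAddCommGroup F] [NormedSpace ℝ F] {g : V → F} {S : Set V}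
    (h : ∀ i : ℕ, ∃ M : ℝ, ∀ x ∈ S, ‖iteratedFDeriv ℝ i g x‖ ≤ M) (n : ℕ) :
    ∃ B : ℝ, 0 ≤ B ∧ ∀ i ≤ n, ∀ x ∈ S, ‖iteratedFDeriv ℝ i g x‖ ≤ B := by
  choose M hM using h
  refine ⟨∑ j ∈ Finset.range (n + 1), |M j|, Finset.sum_nonneg fun j _ => abs_nonneg _, fun i hi x hx => ?_⟩
  calc ‖iteratedFDeriv ℝ i g x‖ ≤ M i := hM i x hx
    _ ≤ |M i| := le_abs_self _
    _ ≤ ∑ j ∈ Finset.range (n + 1), |M j| :=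
        Finset.single_le_sum (f := fun j => |M j|) (fun j _ => abs_nonneg _) (Finset.mem_range.mpr (Nat.lt_succ_of_le hi))

/-- A globally smooth function has all its jets of order `≤ n` bounded by ONE constant on a compact ball (continuity of `Dⁱu` on a compact set). [cite: WarnerHASSLG2, §8.5.1 Thm. 8.5.1.1] -/
theorem exists_forall_le_norm_iteratedFDeriv_le_of_contDiff [ProperSpace V] {F : Type*} [NormedAddCommGroup F] [NormedSpace ℝ F]
    {u : V → F} (hu : ContDiff ℝ ∞ u) (R : ℝ) (n : ℕ) :
    ∃ A : ℝ, 0 ≤ A ∧ ∀ i ≤ n, ∀ x ∈ closedBall (0 : V) R, ‖iteratedFDeriv ℝ i u x‖ ≤ A := by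
  have hb : ∀ i : ℕ, ∃ A : ℝ, ∀ x ∈ closedBall (0 : V) R, ‖iteratedFDeriv ℝ i u x‖ ≤ A := fun i =>
    (isCompact_closedBall (0 : V) R).exists_bound_of_continuousOn
      ((hu.continuous_iteratedFDeriv (m := i) (by exact_mod_cast le_top)).continuousOn)
  exact exists_forall_le_norm_iteratedFDeriv_le hb n

end Literature.Analysis.Calculus

/-! ## §3 The letter's torus orbital integral near the centre IS a Lie-algebra orbital integral `lieOrbital (ν.map e) f (torusH θ)` (frame + (a2-B)) -/

namespace Literature.NumberTheory.Rogawski1990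

open Literature.Analysis.Calculus Literature.NumberTheory.Automorphic Literature.NumberTheory.Automorphic.UnitaryGroup
open Literature.Geometry.ComplexHyperbolic Literature.Geometry.ComplexHyperbolic.BallModel
open NumberField NumberField.InfinitePlace
open scoped Matrix MatrixGroups Matrix.Norms.Operator

variable (L : Type) [Field L] (α : Fin 3 → L) (w : {w : InfinitePlace L // IsComplex w})

/-- **GROUP → ALGEBRA AT THE CENTRE, ON `G_w`**: at a frame with `re σ_wα₀, re σ_wα₁ > 0 > re σ_wα₂` there are a topological-group isomorphism `e : G_w ≃ₜ* U(2,1)` (★ A-p18's diagonal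
frame, identity on the torus) and ONE ambient test function `f ∈ C_c^∞(M₃(ℂ))` such that for every centre-chart angle `θ` with `|θ_k| ≤ 1∕4`:
`∫_{G_w} Θ(g·diag(ζe^{iθ_k})·g⁻¹) dν = lieOrbital (ν.map e) f (torusH θ)` (★ `integral_comp_conj_eq_integral_map_mkU21` then ★ (a2-B) `orbital_eq_lieOrbital` for `Θ∘Ad(T)`).
[cite: WarnerHASSLG2, §8.4.1] [cite: Rogawski1990, §8.4 p. 126] -/
theorem exists_frame_testFunction_orbital_eq_lieOrbital (hreal : ∀ i, (w.1.embedding (α i)).im = 0)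
    (h0 : 0 < (w.1.embedding (α 0)).re) (h1 : 0 < (w.1.embedding (α 1)).re) (h2 : (w.1.embedding (α 2)).re < 0)
    [MeasurableSpace (archLocal L 3 (Matrix.diagonal α) w)] [BorelSpace (archLocal L 3 (Matrix.diagonal α) w)]
    (ν : Measure (archLocal L 3 (Matrix.diagonal α) w)) (Θ : Matrix (Fin 3) (Fin 3) ℂ → ℂ) (hΘ : ContDiff ℝ ∞ Θ)
    (hΘc : HasCompactSupport fun k : archLocal L 3 (Matrix.diagonal α) w => Θ ((k : GL (Fin 3) ℂ) : Matrix (Fin 3) (Fin 3) ℂ)) (ζ : Circle) :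
    ∃ (e : archLocal L 3 (Matrix.diagonal α) w ≃ₜ* U21) (f : Matrix (Fin 3) (Fin 3) ℂ → ℂ), ContDiff ℝ ∞ f ∧ HasCompactSupport f ∧
      ∀ θ : Fin 3 → ℝ, (∀ k, |θ k| ≤ 1 / 4) →
        (∫ g, Θ (((g * ⟨circleDiagonal 3 (fun k => ζ * Circle.exp (θ k)), circleDiagonal_mem_archLocal_diagonal L 3 α w _⟩ * g⁻¹ : archLocal L 3 (Matrix.diagonal α) w) : GL (Fin 3) ℂ) : Matrix (Fin 3) (Fin 3) ℂ) ∂ν)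
          = lieOrbital (ν.map e) f (torusH θ) := by
  obtain ⟨T, e, -, he, hez⟩ := exists_continuousMulEquiv_archLocal_U21_torus L α w hreal h0 h1 h2
  have hΘT : ContDiff ℝ ∞ (fun M : Matrix (Fin 3) (Fin 3) ℂ => Θ ((T : Matrix (Fin 3) (Fin 3) ℂ) * M * ((T⁻¹ : GL (Fin 3) ℂ) : Matrix (Fin 3) (Fin 3) ℂ))) :=
    contDiff_comp_conjFrame T hΘ
  have hΘTc : HasCompactSupport (fun u : U21 => Θ ((T : Matrix (Fin 3) (Fin 3) ℂ) * mat u * ((T⁻¹ : GL (Fin 3) ℂ) : Matrix (Fin 3) (Fin 3) ℂ))) :=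
    hasCompactSupport_comp_conjFrame L α w T e he hΘc
  obtain ⟨f, hf, hfc, -, hint⟩ := orbital_eq_lieOrbital (fun M : Matrix (Fin 3) (Fin 3) ℂ => Θ ((T : Matrix (Fin 3) (Fin 3) ℂ) * M * ((T⁻¹ : GL (Fin 3) ℂ) : Matrix (Fin 3) (Fin 3) ℂ))) hΘT hΘTc ζ
  refine ⟨e, f, hf, hfc, fun θ hθ => ?_⟩
  rw [integral_comp_conj_eq_integral_map_mkU21 L α w T e he hez ν Θ (fun k => ζ * Circle.exp (θ k)) (diagonal_circle_preserves _)]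
  exact hint (ν.map e) θ hθ

/-! ## §4 HEADS: the socket's fourth-jet clause, and the letter, from (d2)-shaped bounds on `liePhi` -/

/-- In the sup norm of `ℝ³`, `θ ∈ B(0,r)` gives `|θ_k| ≤ r` for every `k`. [folklore] -/
private theorem abs_apply_le_of_mem_ball {θ : Fin 3 → ℝ} {r : ℝ} (hθ : θ ∈ ball (0 : Fin 3 → ℝ) r) (k : Fin 3) : |θ k| ≤ r := by
  rw [mem_ball, dist_zero_right] at hθ
  exact ((Real.norm_eq_abs _).symm.le.trans (norm_le_pi_norm θ k)).trans hθ.le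

/-- **HEAD (f1) — THE SOCKET'S FOURTH-JET CLAUSE FROM LIE-ALGEBRA JET BOUNDS.**  At a frame with `re σ_wα₀, re σ_wα₁ > 0 > re σ_wα₂` (the other sign patterns are reached upstream by
★ `ArchCentralLimitFormulaOfPerm`∕`OfSigns`), for a Haar right-invariant `ν`, an ambient smooth `Θ` compactly supported on `G_w`, a centre `ζ` and a chamber `σ`: IF for every Haar
right-invariant `μ` on `U(2,1)` and every `f ∈ C_c^∞(M₃(ℂ))` the jets of HC's `φ_f = liePhi μ f` of every order are bounded on `C_σ ∩ B(0,1∕4)` (the output shape of ROAD «A6-IV» brick (d2),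
Warner Thm. 8.4.3.1), THEN `F_Θ∘chart_ζ` is `C⁴` on `C_σ ∩ B(0,1∕4)` with `‖D⁴(F_Θ∘chart_ζ)‖ ≤ M` there — the `(∃ r M, …)` clause of ★ `of_chamberJetBounds_local`, at `r = 1∕4`.
Proof: `F_Θ∘chart_ζ = u · liePhi (ν.map e) f` on that set (§1 + §3, `liePhi = π • Φ`), both factors smooth there (★ (A1) chamber smoothness, ★ `contDiffAt_liePhi`), Leibniz (§2).
[cite: WarnerHASSLG2, Thm. 8.4.3.1; §8.5.1 Thm. 8.5.1.1] [cite: Rogawski1990, §8.4 p. 126] -/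
theorem letterJetBound_of_liePhiJetBounds (hα : ∀ i, α i ≠ 0) (hreal : ∀ i, (w.1.embedding (α i)).im = 0)
    (h0 : 0 < (w.1.embedding (α 0)).re) (h1 : 0 < (w.1.embedding (α 1)).re) (h2 : (w.1.embedding (α 2)).re < 0)
    [MeasurableSpace (archLocal L 3 (Matrix.diagonal α) w)] [BorelSpace (archLocal L 3 (Matrix.diagonal α) w)]
    (ν : Measure (archLocal L 3 (Matrix.diagonal α) w)) [ν.IsHaarMeasure] [ν.IsMulRightInvariant]
    (Θ : Matrix (Fin 3) (Fin 3) ℂ → ℂ) (hΘ : ContDiff ℝ ∞ Θ)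
    (hΘc : HasCompactSupport fun k : archLocal L 3 (Matrix.diagonal α) w => Θ ((k : GL (Fin 3) ℂ) : Matrix (Fin 3) (Fin 3) ℂ))
    (ζ : Circle) (σ : Equiv.Perm (Fin 3))
    (hball : ∀ (μ : Measure U21) [μ.IsHaarMeasure] [μ.IsMulRightInvariant] (f : Matrix (Fin 3) (Fin 3) ℂ → ℂ), ContDiff ℝ ∞ f → HasCompactSupport f →
      ∀ n : ℕ, ∃ M : ℝ, ∀ θ ∈ {θ : Fin 3 → ℝ | θ (σ 0) < θ (σ 1) ∧ θ (σ 1) < θ (σ 2)} ∩ ball (0 : Fin 3 → ℝ) (1 / 4), ‖iteratedFDeriv ℝ n (liePhi μ f) θ‖ ≤ M) :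
    ∃ (r : ℝ) (M : ℝ≥0), 0 < r ∧ ContDiffOn ℝ 4 (fun θ : Fin 3 → ℝ => ((((ζ * Circle.exp (θ 0) : Circle) : ℂ)) * (((ζ * Circle.exp (θ 2) : Circle) : ℂ))⁻¹) * ((1 - (((ζ * Circle.exp (θ 1) : Circle) : ℂ)) * (((ζ * Circle.exp (θ 0) : Circle) : ℂ))⁻¹) * (1 - (((ζ * Circle.exp (θ 2) : Circle) : ℂ)) * (((ζ * Circle.exp (θ 1) : Circle) : ℂ))⁻¹) * (1 - (((ζ * Circle.exp (θ 2) : Circle) : ℂ)) * (((ζ * Circle.exp (θ 0) : Circle) : ℂ))⁻¹)) * (∫ g, Θ (((g * ⟨circleDiagonal 3 (fun k => ζ * Circle.exp (θ k)), circleDiagonal_mem_archLocal_diagonal L 3 α w _⟩ * g⁻¹ : archLocal L 3 (Matrix.diagonal α) w) : GL (Fin 3) ℂ) : Matrix (Fin 3) (Fin 3) ℂ) ∂ν)) ({θ : Fin 3 → ℝ | θ (σ 0) < θ (σ 1) ∧ θ (σ 1) < θ (σ 2)} ∩ ball 0 r) ∧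
      ∀ θ ∈ {θ : Fin 3 → ℝ | θ (σ 0) < θ (σ 1) ∧ θ (σ 1) < θ (σ 2)} ∩ ball 0 r, ‖iteratedFDeriv ℝ 4 (fun θ : Fin 3 → ℝ => ((((ζ * Circle.exp (θ 0) : Circle) : ℂ)) * (((ζ * Circle.exp (θ 2) : Circle) : ℂ))⁻¹) * ((1 - (((ζ * Circle.exp (θ 1) : Circle) : ℂ)) * (((ζ * Circle.exp (θ 0) : Circle) : ℂ))⁻¹) * (1 - (((ζ * Circle.exp (θ 2) : Circle) : ℂ)) * (((ζ * Circle.exp (θ 1) : Circle) : ℂ))⁻¹) * (1 - (((ζ * Circle.exp (θ 2) : Circle) : ℂ)) * (((ζ * Circle.exp (θ 0) : Circle) : ℂ))⁻¹)) * (∫ g, Θ (((g * ⟨circleDiagonal 3 (fun k => ζ * Circle.exp (θ k)), circleDiagonal_mem_archLocal_diagonal L 3 α w _⟩ * g⁻¹ : archLocal L 3 (Matrix.diagonal α) w) : GL (Fin 3) ℂ) : Matrix (Fin 3) (Fin 3) ℂ) ∂ν)) θ‖₊ ≤ M := by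
  -- §a the data: frame + test function, the Weyl cofactor `u`
  obtain ⟨e, f, hf, hfc, hint⟩ := exists_frame_testFunction_orbital_eq_lieOrbital L α w hreal h0 h1 h2 ν Θ hΘ hΘc ζ
  haveI : (ν.map e).IsHaarMeasure := isHaarMeasure_map_archLocalEquiv L α w e ν
  haveI : (ν.map e).IsMulRightInvariant := isMulRightInvariant_map_archLocalEquiv L α w e ν
  obtain ⟨u, hu, -, hfac⟩ := exists_smooth_rhoWeylDelta_angleChart_eq_mul_rootProduct
  set S : Set (Fin 3 → ℝ) := {θ : Fin 3 → ℝ | θ (σ 0) < θ (σ 1) ∧ θ (σ 1) < θ (σ 2)} ∩ ball (0 : Fin 3 → ℝ) (1 / 4) with hSdef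
  have hS : IsOpen S := (isOpen_chamber σ).inter isOpen_ball
  -- §b on `S`, `F_Θ∘chart = u · liePhi (ν.map e) f`
  have hFS : ∀ θ ∈ S, ((((ζ * Circle.exp (θ 0) : Circle) : ℂ)) * (((ζ * Circle.exp (θ 2) : Circle) : ℂ))⁻¹) * ((1 - (((ζ * Circle.exp (θ 1) : Circle) : ℂ)) * (((ζ * Circle.exp (θ 0) : Circle) : ℂ))⁻¹) * (1 - (((ζ * Circle.exp (θ 2) : Circle) : ℂ)) * (((ζ * Circle.exp (θ 1) : Circle) : ℂ))⁻¹) * (1 - (((ζ * Circle.exp (θ 2) : Circle) : ℂ)) * (((ζ * Circle.exp (θ 0) : Circle) : ℂ))⁻¹)) * (∫ g, Θ (((g * ⟨circleDiagonal 3 (fun k => ζ * Circle.exp (θ k)), circleDiagonal_mem_archLocal_diagonal L 3 α w _⟩ * g⁻¹ : archLocal L 3 (Matrix.diagonal α) w) : GL (Fin 3) ℂ) : Matrix (Fin 3) (Fin 3) ℂ) ∂ν)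
      = u θ * liePhi (ν.map e) f θ := by
    intro θ hθ
    rw [hfac ζ θ, hint θ (fun k => abs_apply_le_of_mem_ball hθ.2 k), liePhi_def, Complex.real_smul, mul_assoc]
  have hFev : ∀ θ ∈ S, (fun θ : Fin 3 → ℝ => ((((ζ * Circle.exp (θ 0) : Circle) : ℂ)) * (((ζ * Circle.exp (θ 2) : Circle) : ℂ))⁻¹) * ((1 - (((ζ * Circle.exp (θ 1) : Circle) : ℂ)) * (((ζ * Circle.exp (θ 0) : Circle) : ℂ))⁻¹) * (1 - (((ζ * Circle.exp (θ 2) : Circle) : ℂ)) * (((ζ * Circle.exp (θ 1) : Circle) : ℂ))⁻¹) * (1 - (((ζ * Circle.exp (θ 2) : Circle) : ℂ)) * (((ζ * Circle.exp (θ 0) : Circle) : ℂ))⁻¹)) * (∫ g, Θ (((g * ⟨circleDiagonal 3 (fun k => ζ * Circle.exp (θ k)), circleDiagonal_mem_archLocal_diagonal L 3 α w _⟩ * g⁻¹ : archLocal L 3 (Matrix.diagonal α) w) : GL (Fin 3) ℂ) : Matrix (Fin 3) (Fin 3) ℂ) ∂ν))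
      =ᶠ[𝓝 θ] (fun θ : Fin 3 → ℝ => u θ * liePhi (ν.map e) f θ) := by
    intro θ hθ
    filter_upwards [hS.mem_nhds hθ] with θ' hθ'
    exact hFS θ' hθ'
  -- §c smoothness of both sides on `S`
  have hF : ContDiffOn ℝ 4 (fun θ : Fin 3 → ℝ => ((((ζ * Circle.exp (θ 0) : Circle) : ℂ)) * (((ζ * Circle.exp (θ 2) : Circle) : ℂ))⁻¹) * ((1 - (((ζ * Circle.exp (θ 1) : Circle) : ℂ)) * (((ζ * Circle.exp (θ 0) : Circle) : ℂ))⁻¹) * (1 - (((ζ * Circle.exp (θ 2) : Circle) : ℂ)) * (((ζ * Circle.exp (θ 1) : Circle) : ℂ))⁻¹) * (1 - (((ζ * Circle.exp (θ 2) : Circle) : ℂ)) * (((ζ * Circle.exp (θ 0) : Circle) : ℂ))⁻¹)) * (∫ g, Θ (((g * ⟨circleDiagonal 3 (fun k => ζ * Circle.exp (θ k)), circleDiagonal_mem_archLocal_diagonal L 3 α w _⟩ * g⁻¹ : archLocal L 3 (Matrix.diagonal α) w) : GL (Fin 3) ℂ) : Matrix (Fin 3) (Fin 3) ℂ) ∂ν))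 S := by
    refine ((contDiffOn_letterIntegrand_angleChart_chamber_ball L α w hα hreal ν Θ hΘ hΘc ζ σ).of_le (WithTop.coe_le_coe.mpr le_top)).mono ?_
    exact inter_subset_inter_right _ (ball_subset_ball (by norm_num))
  have hφ : ContDiffOn ℝ 4 (liePhi (ν.map e) f) S := by
    intro θ hθ
    have hinj := injective_of_mem_chamber hθ.1
    exact ((contDiffAt_liePhi (ν.map e) hf hfc θ (hinj.ne (by decide)) (hinj.ne (by decide))).of_le (WithTop.coe_le_coe.mpr le_top)).contDiffWithinAt
  have huS : ContDiffOn ℝ 4 u S := (hu.of_le (WithTop.coe_le_coe.mpr le_top)).contDiffOn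
  -- §d bounds for the factors
  obtain ⟨A, hA, huA⟩ := exists_forall_le_norm_iteratedFDeriv_le_of_contDiff hu (1 / 4) 4
  have huA' : ∀ i ≤ 4, ∀ θ ∈ S, ‖iteratedFDeriv ℝ i u θ‖ ≤ A := fun i hi θ hθ => huA i hi θ (ball_subset_closedBall hθ.2)
  obtain ⟨B, hB, hφB⟩ := exists_forall_le_norm_iteratedFDeriv_le (hball (ν.map e) f hf hfc) 4
  have hprod := norm_iteratedFDeriv_mul_le_of_isOpen hS huS hφ hA huA' hφB
  -- §e assemble
  refine ⟨1 / 4, ⟨2 ^ 4 * A * B, by positivity⟩, by norm_num, hF, fun θ hθ => ?_⟩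
  have hEq := ((hFev θ hθ).iteratedFDeriv ℝ 4).eq_of_nhds
  rw [← NNReal.coe_le_coe, coe_nnnorm]
  change _ ≤ 2 ^ 4 * A * B
  rw [hEq]
  exact hprod θ hθ

/-- **HEAD (f1′) — THE LETTER AT AN e-PATTERN FRAME FROM LIE-ALGEBRA JET BOUNDS ON ALL SIX CHAMBERS + THE VALUE CLAUSE** (= ★ `of_chamberJetBounds_local` with its `(∃ r M, …)` clause
discharged by `letterJetBound_of_liePhiJetBounds`; the value clause — every corner limit `J` of the third jet within `C_σ` has `Λ(J) = −(c·i)·Θ(ζ•1)` — stays a hypothesis: ROAD «A6-IV» brick (f2)).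
The indefinite-frame guard of the socket is implied by the sign pattern and dropped from `hval`. [cite: WarnerHASSLG2, Thm. 8.4.3.1; §8.5.1 Thm. 8.5.1.1, Thm. 8.5.1.6] [cite: Rogawski1990, §8.4 pp. 126–127] -/
theorem ArchCentralLimitFormulaRankTwo.of_liePhiJetBounds_of_values
    (h0 : 0 < (w.1.embedding (α 0)).re) (h1 : 0 < (w.1.embedding (α 1)).re) (h2 : (w.1.embedding (α 2)).re < 0)
    (hball : ∀ (μ : Measure U21) [μ.IsHaarMeasure] [μ.IsMulRightInvariant] (f : Matrix (Fin 3) (Fin 3) ℂ → ℂ), ContDiff ℝ ∞ f → HasCompactSupport f →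
      ∀ (σ : Equiv.Perm (Fin 3)) (n : ℕ), ∃ M : ℝ, ∀ θ ∈ {θ : Fin 3 → ℝ | θ (σ 0) < θ (σ 1) ∧ θ (σ 1) < θ (σ 2)} ∩ ball (0 : Fin 3 → ℝ) (1 / 4), ‖iteratedFDeriv ℝ n (liePhi μ f) θ‖ ≤ M)
    (hval : ∀ [MeasurableSpace (archLocal L 3 (Matrix.diagonal α) w)] [BorelSpace (archLocal L 3 (Matrix.diagonal α) w)],
      (∀ i, α i ≠ 0) → (∀ i, (w.1.embedding (α i)).im = 0) →
      ∀ (ν : MeasureTheory.Measure (archLocal L 3 (Matrix.diagonal α) w)) [ν.IsHaarMeasure] [ν.IsMulRightInvariant],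
      ∃ c : ℝ, 0 < c ∧
        ∀ (Θ : Matrix (Fin 3) (Fin 3) ℂ → ℂ), ContDiff ℝ (⊤ : ℕ∞) Θ →
          HasCompactSupport (fun k : archLocal L 3 (Matrix.diagonal α) w => Θ ((k : GL (Fin 3) ℂ) : Matrix (Fin 3) (Fin 3) ℂ)) →
          ∀ (ζ : Circle) (σ : Equiv.Perm (Fin 3)) (J : ContinuousMultilinearMap ℝ (fun _ : Fin 3 => Fin 3 → ℝ) ℂ),
            Tendsto (iteratedFDeriv ℝ 3 (fun θ : Fin 3 → ℝ => ((((ζ * Circle.exp (θ 0) : Circle) : ℂ)) * (((ζ * Circle.exp (θ 2) : Circle) : ℂ))⁻¹) * ((1 - (((ζ * Circle.exp (θ 1) : Circle) : ℂ)) * (((ζ * Circle.exp (θ 0) : Circle) : ℂ))⁻¹) * (1 - (((ζ * Circle.exp (θ 2) : Circle) : ℂ)) * (((ζ * Circle.exp (θ 1) : Circle) : ℂ))⁻¹) * (1 - (((ζ * Circle.exp (θ 2) : Circle) : ℂ)) * (((ζ * Circle.exp (θ 0) : Circle) : ℂ))⁻¹)) * (∫ g, Θ (((g * ⟨circleDiagonal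 3 (fun k => ζ * Circle.exp (θ k)), circleDiagonal_mem_archLocal_diagonal L 3 α w _⟩ * g⁻¹ : archLocal L 3 (Matrix.diagonal α) w) : GL (Fin 3) ℂ) : Matrix (Fin 3) (Fin 3) ℂ) ∂ν))) (𝓝[{θ : Fin 3 → ℝ | θ (σ 0) < θ (σ 1) ∧ θ (σ 1) < θ (σ 2)}] 0) (𝓝 J) →
              (1 / 48 : ℂ) * ∑ ε : Fin 3 → Bool, ((((if ε 0 then (1 : ℝ) else -1) * (if ε 1 then (1 : ℝ) else -1) * (if ε 2 then (1 : ℝ) else -1) : ℝ)) : ℂ) * J (fun _ : Fin 3 => ![(if ε 0 then (1 : ℝ) else -1) + (if ε 1 then (1 : ℝ) else -1), -(if ε 0 then (1 : ℝ) else -1) + (if ε 2 then (1 : ℝ) else -1), -(if ε 1 then (1 : ℝ) else -1) - (if ε 2 then (1 : ℝ) else -1)]) =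
                -((c : ℂ) * Complex.I) * Θ ((circleDiagonal 3 (fun _ => ζ) : GL (Fin 3) ℂ) : Matrix (Fin 3) (Fin 3) ℂ)) :
    ArchCentralLimitFormulaRankTwo L α w := by
  refine ArchCentralLimitFormulaRankTwo.of_chamberJetBounds_local fun hα hreal _ ν => ?_
  intro _ _
  obtain ⟨c, hc, hv⟩ := hval hα hreal ν
  exact ⟨c, hc, fun Θ hΘd hΘc ζ σ =>
    ⟨letterJetBound_of_liePhiJetBounds L α w hα hreal h0 h1 h2 ν Θ hΘd hΘc ζ σ (fun μ _ _ f hf hfc n => hball μ f hf hfc σ n), fun J hJ => hv Θ hΘd hΘc ζ σ J hJ⟩⟩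

end Literature.NumberTheory.Rogawski1990

end
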